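import Literature.AlgebraicGeometry.Resolution.AffineBlowup
import HarnessLib

/-!
# The `x`-chart of `Bl_{(x,y,z)} {yz + x² = 0}` is covered by the `y`-chart (crux `FrobeniusLadder.FRationalResolution`, line `Sketch`)

Stub `stub_cover_sq` (worker U5) of the skeleton `Sketch` for crux
stmt-ResolutionOfSingularities-15317. The lead resolves the quadric cone `{yz + x² = 0} ⊆ 𝔸³`
(over any commutative ring `R` containing elements `x, y, z` with `yz + x² = 0`) by the blowing up
`affineBlowup I = Proj R[It]` of an ideal `I ∋ x, y, z`; its charts are the basic opens
`D₊(xt), D₊(yt), D₊(zt)` of `Proj R[It]`. This file proves that the `x`-chart is redundant: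
`D₊(xt) ⊆ D₊(yt)`.

Proof: in the Rees algebra `R[It] ⊆ R[t]` one has `(xt)² = x²t² = −(yz)t² = (yt) · (−(zt))`
(`reesT_sq_eq`, a computation with monomials under `coe_reesT`), hence
`D₊(xt) = D₊((xt)²)` (`Proj.basicOpen_pow`) `⊆ D₊(yt)` (`Proj.basicOpen_mono`, as `yt ∣ (xt)²`).
Folklore over Mathlib's `Proj` API and the tree file `AffineBlowup.lean`; no published fact is used.
-/

-- single-problem summit: the doubled namespace component is forced
set_option linter.dupNamespace false

noncomputable section

namespace Summit.ResolutionOfSingularities.ResolutionOfSingularities.Theorems.FRationalResolution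

open CategoryTheory AlgebraicGeometry TopologicalSpace Literature.AlgebraicGeometry.Resolution

/-- **The Rees-algebra identity `(xt)² = (yt) · (−(zt))`** for `yz + x² = 0`: both sides are the
monomial `x² t² = −(yz) t²` of `R[t]` (`coe_reesT`, `Polynomial.monomial_pow`,
`Polynomial.monomial_mul_monomial`). [folklore] -/
theorem reesT_sq_eq {R : Type} [CommRing R] {I : Ideal R} (x y z : R) (hx : x ∈ I) (hy : y ∈ I)
    (hz : z ∈ I) (hrel : y * z + x ^ 2 = 0) :
    reesT x hx ^ 2 = reesT y hy * -reesT z hz := by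
  have hx2 : x ^ 2 = -(y * z) := eq_neg_of_add_eq_zero_right hrel
  apply Subtype.ext
  simp only [Subalgebra.coe_pow, Subalgebra.coe_mul, Subalgebra.coe_neg, coe_reesT,
    Polynomial.monomial_pow, Polynomial.monomial_mul_monomial, mul_neg, hx2,
    ← Polynomial.monomial_neg]

/-- **The `x`-chart of `Bl_{(x,y,z)} {yz + x² = 0}` lies in the `y`-chart** (stub `stub_cover_sq`
of the skeleton `Sketch`, crux stmt-ResolutionOfSingularities-15317): for `x, y, z ∈ I` with
`yz + x² = 0`, `D₊(xt) ≤ D₊(yt)` in `Proj R[It]`, since `D₊(xt) = D₊((xt)²)`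
(`Proj.basicOpen_pow`) and `(xt)² = (yt)(−zt)` is divisible by `yt` (`reesT_sq_eq`,
`Proj.basicOpen_mono`). [folklore] -/
theorem stub_cover_sq (R : Type) [CommRing R] (I : Ideal R) (x y z : R) (hx : x ∈ I) (hy : y ∈ I)
    (hz : z ∈ I) (hrel : y * z + x ^ 2 = 0) :
    Proj.basicOpen (reesGrading I) (reesT x hx) ≤ Proj.basicOpen (reesGrading I) (reesT y hy) := by
  rw [← Proj.basicOpen_pow (reesGrading I) (reesT x hx) 2 two_pos, reesT_sq_eq x y z hx hy hz hrel]
  exact Proj.basicOpen_mono _ _ _ (dvd_mul_right _ _)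

end Summit.ResolutionOfSingularities.ResolutionOfSingularities.Theorems.FRationalResolution

end
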